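import Literature.NumberTheory.Rogawski1990.FinExplicitTransferFactorDeepValueInert
import Literature.NumberTheory.Rogawski1990.FinExplicitTransferFactorInertExponent
import Literature.NumberTheory.Rogawski1990.FinExplicitTransferFactorSplitPlaceTau
import Literature.NumberTheory.Rogawski1990.FinExplicitTransferFactorLocallyConstant   -- ED. 2: ★ `continuous_finGammaTwo`, ★ `continuous_fst_localMatrix`
import HarnessLib

/-!
# `τ_v(γ_H) = (−1)^{ord_w χ_g(u)}` for EVERY deep `γ_H ∈ H_v` at an unramified inert place — all torus types, `μ_w` possibly RAMIFIED
# ([Rogawski1990] §4.9 p. 55, Prop. 8.1.3 p. 116; [LabesseLanglands1979] §2; [Serre1979] Ch. V §2, Ch. X §1)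

Topic `NumberTheory/Rogawski1990`; namespace `Literature.NumberTheory.Rogawski1990`.  THEOREMS ONLY (no definition, no instance, no notation, no named fact, no `sorry`).
Cell `pub/hodgecm-mathlib` (D-0151), crux H413 = `stmt-HodgeConjecture-24833`, line «N6nsGerm», last open stub `stub_N6nsS3id`; road «S3-tree» (architect A-p16 (g28) census v3
0ca147ac, A-50 depth coordinates), brick **T5-u** (T5 holder F0P3a-p04 (g15)): the `τ_v`-half of `Δ‴_v = τ_v·D_{G∕H,v}·κ_v` (typ-T6b ★ `FinExplicitTransferFactor`) for DEEP `γ_H`,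
UNIFORM IN THE TORUS TYPE and WITHOUT «`μ` unramified at `w`» — the open T5 cell «type (2) × ramified `μ_w`» of the T5 inventory note (bus 15:44Z).  ROAD-INDEPENDENT
(a statement about ★ `finTau` alone).  HONEST LABEL: HC_CM is proved only modulo the printed citations (2 remaining named inputs hLiu418, h413) until rung 0 closes;
nothing printed is asserted here.

THE MATHEMATICS (`v` non-split UNRAMIFIED in `L`, `w ∣ v`, `σ = σ_w`, `ϖ = ι_w ϖ_v`, guard `μ|_{𝕀_{L⁺}} = ω_{L∕L⁺}`).  `τ_v(γ_H) = μ_w(u_w)·μ_w(y)⁻¹` with `y = −χ_g(u)_w ∕ det g_w`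
(★ `finTau_eq_localComponent_of_nonsplit`).  UNITARITY of the `U(Φ₂)`-part `g`: `σ(det g)·det g = 1` (★), `σ(u)·u = 1` (★) and **`σ(tr g)·det g = tr g`** (§1: `g⁻¹ = Φ₂⁻¹ σ(g)ᵀ Φ₂`,
`tr g⁻¹ = tr(adj g)∕det g = tr g∕det g`); hence `σ(χ_g(u)) = χ_g(u)∕(u² det g)` and **`σ y = y · (det g ∕ u²)`** — `y` is `σ`-fixed UP TO THE NORM-ONE UNIT `r = det g∕u²`, which is
DEEP (`|r − 1| ≤ |ϖ^{M₀}|`) when `γ_H` is (`|u − 1|, |det g − 1| ≤ |ϖ^{M₀}|`).  HILBERT 90 NEAR `1` (★ I-4b's trace-one `t`, `t + σt = 1`, `|t| ≤ 1`): `s := t + r·σt ∈ 1 + ϖ^{M₀}𝒪_w`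
has `σ s = r⁻¹ s`, so `f := y·s` is `σ`-fixed: `f = ι_w β`, `β = ϖ_v^n β₀`, `|β₀|_v = 1`, and `μ_w(f) = μ_w(ι_w ϖ_v)^n·μ_w(ι_w β₀) = (−1)^n` (★ `localComponent_toPlace_uniformizer_pow`,
★ `localComponent_map_toPlace_eq_one_of_valued_eq_one` — units are norms at an unramified place), `μ_w(s) = 1` (★ `exists_forall_localComponent_eq_one_of_valued_sub_one_le`),
whence **`μ_w(y) = (−1)^n`, `n = ord_w y = ord_w χ_g(u)`**, and `μ_w(u_w) = 1` likewise.  So **`τ_v(γ_H) = (−1)^n`** for every deep `γ_H` — type (1) (`n = n₀ + n₁`, ★ root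
dictionary `log_valued_eval_finCharpolyTwo_apply_eq_neg_add`), type (2) (`n = min(2N+1, 2M)`, ★ `exists_irredExponents_of_hint`) and the split-in-`H` torus alike; with ★
`finWeylRatio_eq_of_nonsplit` ∕ ★ (D2) this is `Δ‴_v = (−q)^{−n}·κ_v` on matched pairs (§3).  It generalises ★ `finTau_eq_neg_one_zpow_of_nonsplit_of_isUnramifiedIn` (which needs
`μ` unramified at `w` but no depth) and sets the constant of ★ p845204 `exists_finTau_mul_finWeylRatio_eq_of_depths` to `1`.

* §1 `galAdicCompletionMap_trace_mul_det_eq` (`σ(tr g_w)·det g_w = tr g_w`), `galAdicCompletionMap_eval_charpoly_mul_eq` (`σ(χ_g(u)_w)·(u_w²·det g_w) = χ_g(u)_w`),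
  `galAdicCompletionMap_finTauArg_apply` (`σ y = y · det g_w ∕ u_w²`).
* §2 THE CORE `localComponent_eq_neg_one_pow_of_galAdicCompletionMap_eq_mul` (`σ y = y·r`, `r` norm-one deep, `|y| = |ϖ^n|` ⇒ `μ_w(y) = (−1)^n`).
* §3 HEAD **`exists_forall_finTau_eq_neg_one_pow_of_deep`** and the matched-pair value **`exists_forall_finExplicitDelta_eq_neg_pow_mul_kappa_of_deep`**.
* §4 (ED. 2, APPEND-ONLY) THE SAME AS GERMS AT `1 ∈ H_v`: **`eventually_nhds_one_finTau_eq_neg_one_pow`** (`∀ᶠ γ_H in 𝓝 1, |χ_g(u)_w| = |ϖ^n| → τ_v(γ_H) = (−1)^n`) and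
  **`eventually_nhds_one_finExplicitDelta_eq_neg_pow_mul_kappa`** ∕ **`exists_nhds_one_forall_finExplicitDelta_eq_neg_pow_mul_kappa`** (`∃ V ∈ 𝓝 1, ∀ γ_H ∈ V, …` — the END contract's «GEN» currency).

## References
* [Rogawski1990] J. D. Rogawski, *Automorphic Representations of Unitary Groups in Three Variables* (1990): §4.9 p. 55 (`τ`, `D_{G∕H}`), Prop. 8.1.3 p. 116.
* [LabesseLanglands1979] J.-P. Labesse, R. P. Langlands, *L-indistinguishability for SL(2)*, Canad. J. Math. 31 (1979): §2.
* [Serre1979] J.-P. Serre, *Local Fields*, GTM 67: Ch. V §2 Prop. 3 (unramified trace), Ch. X §1 (Hilbert 90).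
* [Omeara1963] O. T. O'Meara, *Introduction to Quadratic Forms*: §63C Example 63:16 (units are norms at an unramified place; `(ϖ, θ) = −1`).
-/

set_option autoImplicit false

noncomputable section

open NumberField IsDedekindDomain Filter Topology Matrix

namespace Literature.NumberTheory.Rogawski1990

open Literature.NumberTheory.Automorphic Literature.NumberTheory.Automorphic.UnitaryGroup Literature.NumberTheory.GaloisRepresentations

variable (L : Type) [Field L] [NumberField L] [IsCMField L] (v : HeightOneSpectrum (𝓞 ↥(maximalRealSubfield L)))
  (w : PlacesOver L v) (hw : IsCMField.complexConj L • w.1 = w.1)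

/-! ## §1 Unitarity of the `U(Φ₂)`-part at the place `w`: `σ(tr g)·det g = tr g` and `σ y = y · det g ∕ u²` -/

section Unitarity

variable (a : (cmDatum L 2 (Matrix.of fun i j : Fin 2 => if i.val + j.val + 1 = 2 then (1 : L) else 0)).Local v ×
    (cmDatum L 1 (Matrix.of fun i j : Fin 1 => if i.val + j.val + 1 = 1 then (1 : L) else 0)).Local v)

include hw in
/-- **`σ_w(det g_w) · det g_w = 1`** at the place `w` (★ `conjLocal_det_fst_mul_det_fst` read at `w`). [cite: Rogawski1990, §4.9 p. 54] -/
theorem galAdicCompletionMap_det_mul_det_eq_one :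
    galAdicCompletionMap (L := L) (IsCMField.complexConj L) hw
        (((a.1.val.val : Matrix (Fin 2) (Fin 2) (LocalRing L v)).map (Pi.evalRingHom (fun w' : PlacesOver L v => w'.1.adicCompletion L) w)).det) *
      ((a.1.val.val : Matrix (Fin 2) (Fin 2) (LocalRing L v)).map (Pi.evalRingHom (fun w' : PlacesOver L v => w'.1.adicCompletion L) w)).det = 1 := by
  have hdw : ((a.1.val.val : Matrix (Fin 2) (Fin 2) (LocalRing L v)).map (Pi.evalRingHom (fun w' : PlacesOver L v => w'.1.adicCompletion L) w)).det =
      (a.1.val.val : Matrix (Fin 2) (Fin 2) (LocalRing L v)).det w :=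
    (RingHom.map_det (Pi.evalRingHom (fun w' : PlacesOver L v => w'.1.adicCompletion L) w) _).symm
  have h := congrArg (fun y : LocalRing L v => y w) (conjLocal_det_fst_mul_det_fst L v a)
  simpa only [Pi.mul_apply, Pi.one_apply, conjLocal_apply_eq_galAdicCompletionMap L v w hw, hdw] using h

include hw in
/-- **`σ_w(tr g_w) · det g_w = tr g_w`** for the `U(Φ₂)`-part `g` of `γ_H ∈ H_v`: the unitarity `σ(g)ᵀ Φ₂ g = Φ₂` gives `g⁻¹ = Φ₂⁻¹ σ(g)ᵀ Φ₂`, so `tr g⁻¹ = σ(tr g)`, and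
`tr g⁻¹ · det g = tr (adj g) = tr g` for a `2 × 2` matrix. [cite: Rogawski1990, §4.9 p. 54] -/
theorem galAdicCompletionMap_trace_mul_det_eq :
    galAdicCompletionMap (L := L) (IsCMField.complexConj L) hw
        (((a.1.val.val : Matrix (Fin 2) (Fin 2) (LocalRing L v)).map (Pi.evalRingHom (fun w' : PlacesOver L v => w'.1.adicCompletion L) w)).trace) *
      ((a.1.val.val : Matrix (Fin 2) (Fin 2) (LocalRing L v)).map (Pi.evalRingHom (fun w' : PlacesOver L v => w'.1.adicCompletion L) w)).det =
      ((a.1.val.val : Matrix (Fin 2) (Fin 2) (LocalRing L v)).map (Pi.evalRingHom (fun w' : PlacesOver L v => w'.1.adicCompletion L) w)).trace := by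
  set σ := galAdicCompletionMap (L := L) (IsCMField.complexConj L) hw with hσdef
  set ew := Pi.evalRingHom (fun w' : PlacesOver L v => w'.1.adicCompletion L) w with hewdef
  set g : Matrix (Fin 2) (Fin 2) (w.1.adicCompletion L) := (a.1.val.val : Matrix (Fin 2) (Fin 2) (LocalRing L v)).map ew with hgdef
  set Φ : Matrix (Fin 2) (Fin 2) (w.1.adicCompletion L) :=
    ((adelicForm L 2 (Matrix.of fun i j : Fin 2 => if i.val + j.val + 1 = 2 then (1 : L) else 0)).map (adeleToLocal L v)).map ew with hΦdef
  -- the unitarity relation at `w`: `(g.map σ)ᵀ * Φ * g = Φ`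
  have hU := mem_unitaryGroupOfForm_iff.mp a.1.2
  have hUw : (g.map σ)ᵀ * Φ * g = Φ := by
    have h := congrArg (fun M : Matrix (Fin 2) (Fin 2) (LocalRing L v) => M.map ew) hU
    simp only [Matrix.map_mul, Matrix.transpose_map, Matrix.map_map] at h
    have hcomp : (ew : LocalRing L v → w.1.adicCompletion L) ∘ (conjLocal L (IsCMField.complexConj L) v) = σ ∘ ew := by
      funext x
      exact conjLocal_apply_eq_galAdicCompletionMap L v w hw x
    rw [hcomp, ← Matrix.map_map] at h
    exact h
  -- entries: `Φ = antidiag(1,1)`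
  have hΦ : Φ = Matrix.of fun i j : Fin 2 => if i.val + j.val + 1 = 2 then (1 : w.1.adicCompletion L) else 0 := by
    ext i j
    rw [hΦdef, Matrix.map_apply, Matrix.map_apply, adelicForm, Matrix.map_apply, Matrix.of_apply, Matrix.of_apply]
    split_ifs <;> simp
  have e00 := congrArg (fun M : Matrix (Fin 2) (Fin 2) (w.1.adicCompletion L) => M 0 0) hUw
  have e01 := congrArg (fun M : Matrix (Fin 2) (Fin 2) (w.1.adicCompletion L) => M 0 1) hUw
  have e10 := congrArg (fun M : Matrix (Fin 2) (Fin 2) (w.1.adicCompletion L) => M 1 0) hUw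
  have e11 := congrArg (fun M : Matrix (Fin 2) (Fin 2) (w.1.adicCompletion L) => M 1 1) hUw
  simp only [hΦ, Matrix.mul_apply, Matrix.transpose_apply, Matrix.map_apply, Matrix.of_apply, Fin.sum_univ_two, Fin.val_zero, Fin.val_one,
    Fin.isValue] at e00 e01 e10 e11
  norm_num at e00 e01 e10 e11
  rw [Matrix.trace_fin_two, Matrix.det_fin_two, map_add]
  linear_combination (g 0 0) * e01 + (g 1 1) * e10 - (g 0 1) * e00 - (g 1 0) * e11

include hw in
/-- **`σ_w(χ_g(u)_w) · (u_w² · det g_w) = χ_g(u)_w`** — from `χ_g(u)_w = u_w² − tr(g_w) u_w + det g_w` (★), `σ(u_w)u_w = 1`, `σ(det g_w) det g_w = 1`, `σ(tr g_w) det g_w = tr g_w`.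
[cite: Rogawski1990, §4.9 p. 55] -/
theorem galAdicCompletionMap_eval_charpoly_mul_eq :
    galAdicCompletionMap (L := L) (IsCMField.complexConj L) hw (((finCharpolyTwo L v a).eval (finGammaTwo L v a)) w) *
      (finGammaTwo L v a w ^ 2 *
        ((a.1.val.val : Matrix (Fin 2) (Fin 2) (LocalRing L v)).map (Pi.evalRingHom (fun w' : PlacesOver L v => w'.1.adicCompletion L) w)).det) =
      ((finCharpolyTwo L v a).eval (finGammaTwo L v a)) w := by
  set σ := galAdicCompletionMap (L := L) (IsCMField.complexConj L) hw with hσdef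
  have hq := eval_finCharpolyTwo_finGammaTwo_apply_eq_quadratic L v w a
  have hu : σ (finGammaTwo L v a w) * finGammaTwo L v a w = 1 := by
    have h := congrArg (fun y : LocalRing L v => y w) (conjLocal_finGammaTwo_mul_finGammaTwo L v a)
    simpa only [Pi.mul_apply, Pi.one_apply, conjLocal_apply_eq_galAdicCompletionMap L v w hw] using h
  have hd := galAdicCompletionMap_det_mul_det_eq_one L v w hw a
  have ht := galAdicCompletionMap_trace_mul_det_eq L v w hw a
  rw [hq, map_add, map_sub, map_mul, map_pow]
  set u := finGammaTwo L v a w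
  set d := ((a.1.val.val : Matrix (Fin 2) (Fin 2) (LocalRing L v)).map (Pi.evalRingHom (fun w' : PlacesOver L v => w'.1.adicCompletion L) w)).det
  set t := ((a.1.val.val : Matrix (Fin 2) (Fin 2) (LocalRing L v)).map (Pi.evalRingHom (fun w' : PlacesOver L v => w'.1.adicCompletion L) w)).trace
  linear_combination (d * (σ u * u + 1) - u * t) * hu - (u * σ u * u) * ht + u ^ 2 * hd

include hw in
/-- **`σ_w(y) = y · (det g_w ∕ u_w²)`** for `y = t_w = −χ_g(u)_w ∕ det g_w` (★ `finTauArg_apply`): `y` is `σ_w`-fixed up to the norm-one unit `det g_w ∕ u_w²`.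
[cite: Rogawski1990, §4.9 p. 55] -/
theorem galAdicCompletionMap_finTauArg_apply :
    galAdicCompletionMap (L := L) (IsCMField.complexConj L) hw (finTauArg L v a w) =
      finTauArg L v a w *
        (((a.1.val.val : Matrix (Fin 2) (Fin 2) (LocalRing L v)).map (Pi.evalRingHom (fun w' : PlacesOver L v => w'.1.adicCompletion L) w)).det /
          finGammaTwo L v a w ^ 2) := by
  set σ := galAdicCompletionMap (L := L) (IsCMField.complexConj L) hw with hσdef
  set u := finGammaTwo L v a w with hudef
  set χw := ((finCharpolyTwo L v a).eval (finGammaTwo L v a)) w with hχwdef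
  set d := ((a.1.val.val : Matrix (Fin 2) (Fin 2) (LocalRing L v)).map (Pi.evalRingHom (fun w' : PlacesOver L v => w'.1.adicCompletion L) w)).det
    with hddef
  have hσu : σ u * u = 1 := by
    have h := congrArg (fun y : LocalRing L v => y w) (conjLocal_finGammaTwo_mul_finGammaTwo L v a)
    simpa only [Pi.mul_apply, Pi.one_apply, conjLocal_apply_eq_galAdicCompletionMap L v w hw] using h
  have hσd : σ d * d = 1 := galAdicCompletionMap_det_mul_det_eq_one L v w hw a
  have hu0 : u ≠ 0 := fun h0 => by rw [h0, mul_zero] at hσu; exact zero_ne_one hσu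
  have hd0 : d ≠ 0 := fun h0 => by rw [h0, mul_zero] at hσd; exact zero_ne_one hσd
  have hσχ : σ χw = χw / (u ^ 2 * d) := by
    rw [eq_div_iff (mul_ne_zero (pow_ne_zero 2 hu0) hd0)]
    exact galAdicCompletionMap_eval_charpoly_mul_eq L v w hw a
  have hσdinv : σ d⁻¹ = d := by rw [map_inv₀, eq_inv_of_mul_eq_one_left hσd, inv_inv]
  have hy : finTauArg L v a w = -χw * d⁻¹ := finTauArg_apply L v a w
  rw [hy, map_mul, map_neg, hσχ, hσdinv]
  field_simp

end Unitarity

/-! ## §2 THE CORE: `μ_w(y) = (−1)^{ord_w y}` for `y` that is `σ`-fixed up to a deep norm-one unit -/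

section Core

variable (hunr : Algebra.IsUnramifiedIn (𝓞 L) v.asIdeal) (μ : HeckeCharacter L)
  (hμω : ∀ x : ideleGroup ↥(maximalRealSubfield L), μ (AdeleRing.ideleBaseChange ↥(maximalRealSubfield L) L x) = quadraticHeckeCharCM L x)

include hw hunr hμω in
/-- **THE CORE.**  At a non-split `v` unramified in `L`, under the guard, with `M₀ ≥ 1` a level on which `μ_w` is trivial (`hM₀`): if `y ≠ 0` has `|y|_w = |ϖ^n|_w` and
`σ_w y = y·r` for a norm-one `r` (`σr·r = 1`) with `|r − 1|_w ≤ |ϖ^{M₀}|_w`, then **`μ_w(y) = (−1)^n`**.  Hilbert 90 near `1`: with `t + σt = 1`, `|t| ≤ 1` (★), `s := t + r·σt`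
satisfies `σs = r⁻¹ s` and `|s − 1| ≤ |ϖ^{M₀}|`, so `f := y s` is `σ`-fixed, `f = ι_w(ϖ_v^n β₀)` with `|β₀|_v = 1`, `μ_w(f) = (−1)^n` (units are norms, `(ϖ_v, θ)_v = −1`), `μ_w(s) = 1`.
[cite: Serre1979, Ch. X §1; Ch. V §2 Prop. 3] [cite: Omeara1963, §63C Example 63:16] [cite: Rogawski1990, §4.9 p. 55] -/
theorem localComponent_eq_neg_one_pow_of_galAdicCompletionMap_eq_mul
    {M₀ : ℕ} (hM₁ : 1 ≤ M₀) (hM₀ : ∀ (s : w.1.adicCompletion L) (hs : s ≠ 0),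
      Valued.v (s - 1) ≤ Valued.v ((toPlace v w (HeckeCharacter.uniformizer ↥(maximalRealSubfield L) v : v.adicCompletion ↥(maximalRealSubfield L))) ^ M₀) →
      μ.localComponent w.1 (Units.mk0 s hs) = 1)
    {y r : w.1.adicCompletion L} {n : ℕ} (hy0 : y ≠ 0)
    (hyv : Valued.v y = Valued.v ((toPlace v w (HeckeCharacter.uniformizer ↥(maximalRealSubfield L) v : v.adicCompletion ↥(maximalRealSubfield L))) ^ n))
    (hσy : galAdicCompletionMap (L := L) (IsCMField.complexConj L) hw y = y * r)
    (hr : galAdicCompletionMap (L := L) (IsCMField.complexConj L) hw r * r = 1)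
    (hrd : Valued.v (r - 1) ≤ Valued.v ((toPlace v w (HeckeCharacter.uniformizer ↥(maximalRealSubfield L) v : v.adicCompletion ↥(maximalRealSubfield L))) ^ M₀)) :
    ((μ.localComponent w.1 (Units.mk0 y hy0) : ℂˣ) : ℂ) = (-1 : ℂ) ^ n := by
  classical
  haveI : Algebra.IsQuadraticExtension ↥(maximalRealSubfield L) L := IsCMField.isQuadraticExtension L
  have hc1 : IsCMField.complexConj L ≠ 1 := IsCMField.complexConj_ne_one L
  set σ := galAdicCompletionMap (L := L) (IsCMField.complexConj L) hw with hσdef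
  set ϖF : v.adicCompletion ↥(maximalRealSubfield L) := (HeckeCharacter.uniformizer ↥(maximalRealSubfield L) v : v.adicCompletion ↥(maximalRealSubfield L))
    with hϖFdef
  set ϖ : w.1.adicCompletion L := toPlace v w ϖF with hϖdef
  have hσσ : ∀ x, σ (σ x) = x := fun x => galAdicCompletionMap_galAdicCompletionMap_of_smul_eq (IsCMField.complexConj L) w hc1 hw x
  have hσv : ∀ x, Valued.v (σ x) = Valued.v x := fun x => valued_galAdicCompletionMap (L := L) (IsCMField.complexConj L) hw x
  have hϖv : Valued.v ϖ = WithZero.exp (-1 : ℤ) := Liu2021.LemD1IndexedNonVacuityInertCofinite.valued_toPlace_uniformizer_of_isUnramifiedIn L v hunr w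
  have hϖ1 : Valued.v ϖ < 1 := by rw [hϖv, ← WithZero.exp_zero]; exact WithZero.exp_lt_exp.2 (by norm_num)
  have hϖ0 : ϖ ≠ 0 := fun h0 => by rw [h0, map_zero] at hϖv; exact WithZero.zero_ne_coe hϖv
  have hϖn0 : ϖ ^ n ≠ 0 := pow_ne_zero _ hϖ0
  -- `r` is a unit with `σ r = r⁻¹`
  have hϖM1 : Valued.v (ϖ ^ M₀) < 1 := by rw [Valuation.map_pow]; exact pow_lt_one₀ zero_le hϖ1 (by omega)
  have hvr1 : Valued.v (r - 1) < 1 := lt_of_le_of_lt hrd hϖM1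
  have hvr : Valued.v r = 1 := by
    have h := Valuation.map_one_add_of_lt (Valued.v : Valuation (w.1.adicCompletion L) _) hvr1
    rwa [add_sub_cancel] at h
  have hr0 : r ≠ 0 := fun h0 => by rw [h0, map_zero] at hvr; exact zero_ne_one hvr
  have hσr : σ r = r⁻¹ := eq_inv_of_mul_eq_one_left hr
  -- the trace-one element and `s := t + r σ t = 1 + (r - 1) σ t`
  obtain ⟨t, htv, ht⟩ := exists_add_galAdicCompletionMap_eq_one L v w hw hunr
  set s : w.1.adicCompletion L := t + r * σ t with hsdef
  have hs1 : s - 1 = (r - 1) * σ t := by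
    rw [hsdef]
    linear_combination ht
  have hsv1 : Valued.v (s - 1) ≤ Valued.v (ϖ ^ M₀) := by
    rw [hs1, Valuation.map_mul, hσv]
    calc Valued.v (r - 1) * Valued.v t ≤ Valued.v (ϖ ^ M₀) * 1 := by gcongr
      _ = Valued.v (ϖ ^ M₀) := mul_one _
  have hsvlt : Valued.v (s - 1) < 1 := lt_of_le_of_lt hsv1 hϖM1
  have hvs : Valued.v s = 1 := by
    have h := Valuation.map_one_add_of_lt (Valued.v : Valuation (w.1.adicCompletion L) _) hsvlt
    rwa [add_sub_cancel] at h
  have hs0 : s ≠ 0 := fun h0 => by rw [h0, map_zero] at hvs; exact zero_ne_one hvs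
  have hμs : μ.localComponent w.1 (Units.mk0 s hs0) = 1 := hM₀ s hs0 hsv1
  have hσs : σ s = r⁻¹ * s := by
    rw [hsdef, map_add, map_mul, hσσ, hσr]
    field_simp
    ring
  -- `f := y * s` is `σ`-fixed, hence from `L⁺_v`: `f = ι_w p`, `p = ϖ_v^n · p₀`, `|p₀|_v = 1`
  have hf0 : y * s ≠ 0 := mul_ne_zero hy0 hs0
  have hσf : σ (y * s) = y * s := by
    rw [map_mul, hσy, hσs]
    field_simp
  obtain ⟨p, hp⟩ := exists_toPlace_eq_of_galAdicCompletionMap_eq (IsCMField.complexConj L) w hc1 hw (y * s) hσf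
  have hfv : Valued.v (y * s) = Valued.v (ϖ ^ n) := by rw [Valuation.map_mul, hyv, hvs, mul_one]
  set p₀ : v.adicCompletion ↥(maximalRealSubfield L) := p / ϖF ^ n with hp₀def
  have hιp₀ : toPlace v w p₀ = y * s / ϖ ^ n := by rw [hp₀def, map_div₀, map_pow, hp]
  have hp₀v : Valued.v p₀ = 1 := by
    refine valued_eq_one_of_valued_toPlace_eq_one L v w ?_
    rw [hιp₀, Valuation.map_div, hfv, div_self ((Valuation.ne_zero_iff _).2 hϖn0)]
  have hp₀0 : p₀ ≠ 0 := fun h0 => by rw [h0, map_zero] at hp₀v; exact zero_ne_one hp₀v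
  -- the unit bookkeeping `y = ϖ^n · ι p₀ · s⁻¹`
  have hfu : Units.mk0 (y * s) hf0 =
      Units.mk0 (ϖ ^ n) hϖn0 * Units.map (toPlace v w : v.adicCompletion ↥(maximalRealSubfield L) →* w.1.adicCompletion L) (Units.mk0 p₀ hp₀0) :=
    Units.ext (by
      rw [Units.val_mul, Units.val_mk0, Units.val_mk0, Units.coe_map, MonoidHom.coe_coe, Units.val_mk0, hιp₀, mul_div_cancel₀ _ hϖn0])
  have hμf : ((μ.localComponent w.1 (Units.mk0 (y * s) hf0) : ℂˣ) : ℂ) = (-1 : ℂ) ^ n := by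
    rw [hfu, map_mul, Units.val_mul, localComponent_toPlace_uniformizer_pow L v w hw hunr μ hμω hϖdef n hϖn0,
      localComponent_map_toPlace_eq_one_of_valued_eq_one L v w hw hunr μ hμω (Units.mk0 p₀ hp₀0) hp₀v, Units.val_one, mul_one]
  have hyu : Units.mk0 y hy0 = Units.mk0 (y * s) hf0 * (Units.mk0 s hs0)⁻¹ :=
    Units.ext (by rw [Units.val_mul, Units.val_inv_eq_inv_val, Units.val_mk0, Units.val_mk0, Units.val_mk0, mul_inv_cancel_right₀ hs0])
  rw [hyu, map_mul, map_inv, hμs, inv_one, mul_one, hμf]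

end Core

/-! ## §3 HEAD: `τ_v(γ_H) = (−1)^n` for every deep `γ_H`; `Δ‴_v = (−q)^{−n}·κ_v` on matched pairs -/

section Head

variable (hunr : Algebra.IsUnramifiedIn (𝓞 L) v.asIdeal) (μ : HeckeCharacter L)
  (hμω : ∀ x : ideleGroup ↥(maximalRealSubfield L), μ (AdeleRing.ideleBaseChange ↥(maximalRealSubfield L) L x) = quadraticHeckeCharCM L x)

include hw hunr hμω in
/-- **HEAD (T5-u) — `τ_v(γ_H) = (−1)^n` FOR EVERY DEEP `γ_H`, ALL TORUS TYPES, `μ_w` POSSIBLY RAMIFIED.**  At a non-split place `v` unramified in the CM field `L` (`w ∣ v`), for a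
Hecke character `μ` with print's guard `μ|_{𝕀_{L⁺}} = ω_{L∕L⁺}`, there is a level `M₀ ≥ 1` such that for every `γ_H = (g, u) ∈ H_v` with `|χ_g(u)_w|_w = |ϖ_v|_w^n` (`n = ord_w χ_g(u)`:
`n₀ + n₁` on a type-(1) torus, `min(2N+1, 2M)` on a type-(2) torus — ★ root∕irreducible exponent dictionaries), `|u_w − 1|_w ≤ |ϖ_v|_w^{M₀}` and
`|det g_w − 1|_w ≤ |ϖ_v|_w^{M₀}`:  **`τ_v(γ_H) = (−1)^n`**. [cite: Rogawski1990, §4.9 p. 55; Prop. 8.1.3 p. 116] [cite: LabesseLanglands1979, §2] -/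
theorem exists_forall_finTau_eq_neg_one_pow_of_deep :
    ∃ M₀ : ℕ, 1 ≤ M₀ ∧
      ∀ (γH : (cmDatum L 2 (Matrix.of fun i j : Fin 2 => if i.val + j.val + 1 = 2 then (1 : L) else 0)).Local v ×
          (cmDatum L 1 (Matrix.of fun i j : Fin 1 => if i.val + j.val + 1 = 1 then (1 : L) else 0)).Local v) (n : ℕ),
        Valued.v (((finCharpolyTwo L v γH).eval (finGammaTwo L v γH)) w) =
          Valued.v ((toPlace v w (HeckeCharacter.uniformizer ↥(maximalRealSubfield L) v : v.adicCompletion ↥(maximalRealSubfield L))) ^ n) →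
        Valued.v (finGammaTwo L v γH w - 1) ≤
          Valued.v ((toPlace v w (HeckeCharacter.uniformizer ↥(maximalRealSubfield L) v : v.adicCompletion ↥(maximalRealSubfield L))) ^ M₀) →
        Valued.v (((γH.1.val.val : Matrix (Fin 2) (Fin 2) (LocalRing L v)).map
            (Pi.evalRingHom (fun w' : PlacesOver L v => w'.1.adicCompletion L) w)).det - 1) ≤
          Valued.v ((toPlace v w (HeckeCharacter.uniformizer ↥(maximalRealSubfield L) v : v.adicCompletion ↥(maximalRealSubfield L))) ^ M₀) →
        finTau L v γH μ = (-1 : ℂ) ^ n := by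
  classical
  haveI : Algebra.IsQuadraticExtension ↥(maximalRealSubfield L) L := IsCMField.isQuadraticExtension L
  have hc1 : IsCMField.complexConj L ≠ 1 := IsCMField.complexConj_ne_one L
  haveI hv : Subsingleton (PlacesOver L v) := PlacesOver.subsingleton_of_smul_eq (IsCMField.complexConj L) hc1 w hw
  obtain ⟨M₀, hM₁, hM₀⟩ := exists_forall_localComponent_eq_one_of_valued_sub_one_le L v w μ
  refine ⟨M₀, hM₁, fun γH n hχ hud hdd => ?_⟩
  set σ := galAdicCompletionMap (L := L) (IsCMField.complexConj L) hw with hσdef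
  set ϖ : w.1.adicCompletion L := toPlace v w (HeckeCharacter.uniformizer ↥(maximalRealSubfield L) v : v.adicCompletion ↥(maximalRealSubfield L)) with hϖdef
  set u := finGammaTwo L v γH w with hudef
  set χw := ((finCharpolyTwo L v γH).eval (finGammaTwo L v γH)) w with hχwdef
  set d := ((γH.1.val.val : Matrix (Fin 2) (Fin 2) (LocalRing L v)).map (Pi.evalRingHom (fun w' : PlacesOver L v => w'.1.adicCompletion L) w)).det with hddef
  have hϖv : Valued.v ϖ = WithZero.exp (-1 : ℤ) := Liu2021.LemD1IndexedNonVacuityInertCofinite.valued_toPlace_uniformizer_of_isUnramifiedIn L v hunr w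
  have hϖ1 : Valued.v ϖ < 1 := by rw [hϖv, ← WithZero.exp_zero]; exact WithZero.exp_lt_exp.2 (by norm_num)
  have hϖ0 : ϖ ≠ 0 := fun h0 => by rw [h0, map_zero] at hϖv; exact WithZero.zero_ne_coe hϖv
  have hϖM1 : Valued.v (ϖ ^ M₀) < 1 := by rw [Valuation.map_pow]; exact pow_lt_one₀ zero_le hϖ1 (by omega)
  -- units: `u`, `d`, `χ_g(u)`
  have hσu : σ u * u = 1 := by
    have h := congrArg (fun y : LocalRing L v => y w) (conjLocal_finGammaTwo_mul_finGammaTwo L v γH)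
    simpa only [Pi.mul_apply, Pi.one_apply, conjLocal_apply_eq_galAdicCompletionMap L v w hw] using h
  have hσd : σ d * d = 1 := galAdicCompletionMap_det_mul_det_eq_one L v w hw γH
  have hvu : Valued.v u = 1 := by
    have hlt : Valued.v (u - 1) < 1 := lt_of_le_of_lt hud hϖM1
    have h := Valuation.map_one_add_of_lt (Valued.v : Valuation (w.1.adicCompletion L) _) hlt
    rwa [add_sub_cancel] at h
  have hu0 : u ≠ 0 := fun h0 => by rw [h0, map_zero] at hvu; exact zero_ne_one hvu
  have hvd : Valued.v d = 1 := by
    have hlt : Valued.v (d - 1) < 1 := lt_of_le_of_lt hdd hϖM1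
    have h := Valuation.map_one_add_of_lt (Valued.v : Valuation (w.1.adicCompletion L) _) hlt
    rwa [add_sub_cancel] at h
  have hd0 : d ≠ 0 := fun h0 => by rw [h0, map_zero] at hvd; exact zero_ne_one hvd
  have hχ0 : χw ≠ 0 := fun h0 => by
    rw [h0, map_zero] at hχ
    exact (Valuation.ne_zero_iff _).2 (pow_ne_zero n hϖ0) hχ.symm
  have hχu : IsUnit ((finCharpolyTwo L v γH).eval (finGammaTwo L v γH)) := by
    refine isUnit_localRing_of_ne_zero_of_subsingleton L v hv fun h0 => hχ0 ?_
    rw [hχwdef, h0, Pi.zero_apply]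
  -- `τ = μ_w(u) · μ_w(y)⁻¹`, `y = t_w`
  rw [finTau_eq_localComponent_of_nonsplit L v γH w hw μ hχu]
  have hy : finTauArg L v γH w = -χw * d⁻¹ := finTauArg_apply L v γH w
  have hy0 : finTauArg L v γH w ≠ 0 := by rw [hy]; exact mul_ne_zero (neg_ne_zero.2 hχ0) (inv_ne_zero hd0)
  have hunitu : MulEquiv.piUnits (isUnit_finGammaTwo L v γH).unit w = Units.mk0 u hu0 := Units.ext rfl
  have hunity : MulEquiv.piUnits (isUnit_finTauArg_of_isUnit L v γH hχu).unit w = Units.mk0 (finTauArg L v γH w) hy0 := Units.ext rfl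
  rw [hunitu, hunity, hM₀ u hu0 hud, Units.val_one, one_mul]
  -- apply the core to `y` with `r := d / u²`
  have hyv : Valued.v (finTauArg L v γH w) = Valued.v (ϖ ^ n) := by rw [valued_finTauArg_apply_eq L v γH w hw]; exact hχ
  have hσy : σ (finTauArg L v γH w) = finTauArg L v γH w * (d / u ^ 2) := galAdicCompletionMap_finTauArg_apply L v w hw γH
  have hr : σ (d / u ^ 2) * (d / u ^ 2) = 1 := by
    rw [map_div₀, map_pow]
    have h1 : σ d = d⁻¹ := eq_inv_of_mul_eq_one_left hσd
    have h2 : σ u = u⁻¹ := eq_inv_of_mul_eq_one_left hσu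
    rw [h1, h2]
    field_simp
  have hrd : Valued.v (d / u ^ 2 - 1) ≤ Valued.v (ϖ ^ M₀) := by
    have hsub : d / u ^ 2 - 1 = (d - 1 - (u - 1) * (u + 1)) / u ^ 2 := by field_simp; ring
    rw [hsub, Valuation.map_div, Valuation.map_pow, hvu, one_pow, div_one]
    refine le_trans (Valuation.map_sub _ _ _) (max_le hdd ?_)
    rw [Valuation.map_mul]
    calc Valued.v (u - 1) * Valued.v (u + 1) ≤ Valued.v (ϖ ^ M₀) * 1 := by
          gcongr
          exact le_trans (Valuation.map_add _ _ _) (max_le hvu.le (le_of_eq (Valuation.map_one _)))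
      _ = Valued.v (ϖ ^ M₀) := mul_one _
  rw [localComponent_eq_neg_one_pow_of_galAdicCompletionMap_eq_mul L v w hw hunr μ hμω hM₁ hM₀ hy0 hyv hσy hr hrd, ← inv_pow, inv_neg, inv_one]

include hw hunr hμω in
/-- **`Δ‴_v(γ_H, γ′) = (−1)^n q_v^{−n} · κ_v(γ_H, γ′)` ON MATCHED PAIRS, FOR EVERY DEEP `γ_H`** (`q_v = #k_v`): ★ `finExplicitDelta_of_isLocalNormPair` (`Δ‴ = τ·D·κ`),
the head (`τ = (−1)^n`) and ★ `sqrt_prod_norm_eq_inv_pow` (`D = (Π_{w′}‖χ_g(u)_{w′}‖)^{1∕2} = q_v^{−n}`).  With the ★ exponent dictionaries `n = n₀ + n₁` (type (1)) ∕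
`n = min(2N+1, 2M)` (type (2)) this is print's `Δ_{G∕H} = (−q)^{−(N₁+N₂)}` near the identity. [cite: Rogawski1990, §4.9 p. 55; Prop. 8.1.3 p. 116] [cite: LabesseLanglands1979, §2] -/
theorem exists_forall_finExplicitDelta_eq_neg_pow_mul_kappa_of_deep (H' : Matrix (Fin 3) (Fin 3) L) :
    ∃ M₀ : ℕ, 1 ≤ M₀ ∧
      ∀ (γH : (cmDatum L 2 (Matrix.of fun i j : Fin 2 => if i.val + j.val + 1 = 2 then (1 : L) else 0)).Local v ×
          (cmDatum L 1 (Matrix.of fun i j : Fin 1 => if i.val + j.val + 1 = 1 then (1 : L) else 0)).Local v) (n : ℕ)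
        (γ' : (cmDatum L 3 H').Local v),
        Valued.v (((finCharpolyTwo L v γH).eval (finGammaTwo L v γH)) w) =
          Valued.v ((toPlace v w (HeckeCharacter.uniformizer ↥(maximalRealSubfield L) v : v.adicCompletion ↥(maximalRealSubfield L))) ^ n) →
        Valued.v (finGammaTwo L v γH w - 1) ≤
          Valued.v ((toPlace v w (HeckeCharacter.uniformizer ↥(maximalRealSubfield L) v : v.adicCompletion ↥(maximalRealSubfield L))) ^ M₀) →
        Valued.v (((γH.1.val.val : Matrix (Fin 2) (Fin 2) (LocalRing L v)).map
            (Pi.evalRingHom (fun w' : PlacesOver L v => w'.1.adicCompletion L) w)).det - 1) ≤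
          Valued.v ((toPlace v w (HeckeCharacter.uniformizer ↥(maximalRealSubfield L) v : v.adicCompletion ↥(maximalRealSubfield L))) ^ M₀) →
        IsLocalNormPair L H' v γH γ' →
        finExplicitDelta L v H' γH μ γ' =
          (-1 : ℂ) ^ n * (((Nat.card (𝓞 ↥(maximalRealSubfield L) ⧸ v.asIdeal) : ℂ) ^ n))⁻¹ * ((finKappaAt L v H' γH γ' : ℤ) : ℂ) := by
  classical
  obtain ⟨M₀, hM₁, h⟩ := exists_forall_finTau_eq_neg_one_pow_of_deep L v w hw hunr μ hμω
  refine ⟨M₀, hM₁, fun γH n γ' hχ hud hdd hpair => ?_⟩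
  rw [finExplicitDelta_of_isLocalNormPair L v H' γH μ hpair, h γH n hχ hud hdd,
    show finWeylRatio L v γH = Real.sqrt (∏ w' : PlacesOver L v, ‖(finCharpolyTwo L v γH).eval (finGammaTwo L v γH) w'‖) from rfl,
    sqrt_prod_norm_eq_inv_pow L v w hw hunr hχ]
  push_cast
  ring

end Head

/-! ## §4 (ED. 2) GERM FORM AT `1 ∈ H_v`: the depth conditions `|u_w − 1|, |det g_w − 1| ≤ |ϖ^{M₀}|` cut out a neighbourhood of `1` -/

section Germ

variable (hunr : Algebra.IsUnramifiedIn (𝓞 L) v.asIdeal) (μ : HeckeCharacter L)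
  (hμω : ∀ x : ideleGroup ↥(maximalRealSubfield L), μ (AdeleRing.ideleBaseChange ↥(maximalRealSubfield L) L x) = quadraticHeckeCharCM L x)

omit [IsCMField L] in
/-- The valuation ball `{x | |x − 1|_w ≤ |c|_w}` (`c ≠ 0`) is a neighbourhood of `1` in `L_w`. [cite: Serre1979, Ch. II §1] -/
private theorem setOf_valued_sub_one_le_mem_nhds_one {c : w.1.adicCompletion L} (hc : c ≠ 0) :
    {x : w.1.adicCompletion L | Valued.v (x - 1) ≤ Valued.v c} ∈ 𝓝 (1 : w.1.adicCompletion L) := by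
  refine Filter.mem_of_superset (Metric.closedBall_mem_nhds (1 : w.1.adicCompletion L) (norm_pos_iff.2 hc)) fun x hx => ?_
  rw [Metric.mem_closedBall, dist_eq_norm] at hx
  exact Valued.toNormedField.norm_le_iff.1 hx

/-- **The depth conditions cut out a neighbourhood of `1 ∈ H_v`:** for `c ≠ 0` in `L_w`, eventually near `1`, `|u_w − 1|_w ≤ |c|_w` and `|det g_w − 1|_w ≤ |c|_w`
(`γ_H ↦ u_w`, `γ_H ↦ det g_w` are continuous ★ and equal `1` at `γ_H = 1`). [cite: Rogawski1990, §4.9 p. 55; Prop. 8.1.3 p. 116] -/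
theorem eventually_nhds_one_valued_sub_one_le {c : w.1.adicCompletion L} (hc : c ≠ 0) :
    ∀ᶠ γH : (cmDatum L 2 (Matrix.of fun i j : Fin 2 => if i.val + j.val + 1 = 2 then (1 : L) else 0)).Local v ×
        (cmDatum L 1 (Matrix.of fun i j : Fin 1 => if i.val + j.val + 1 = 1 then (1 : L) else 0)).Local v in 𝓝 1,
      Valued.v (finGammaTwo L v γH w - 1) ≤ Valued.v c ∧
        Valued.v (((γH.1.val.val : Matrix (Fin 2) (Fin 2) (LocalRing L v)).map
            (Pi.evalRingHom (fun w' : PlacesOver L v => w'.1.adicCompletion L) w)).det - 1) ≤ Valued.v c := by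
  have hcu : Continuous fun γH : (cmDatum L 2 (Matrix.of fun i j : Fin 2 => if i.val + j.val + 1 = 2 then (1 : L) else 0)).Local v ×
        (cmDatum L 1 (Matrix.of fun i j : Fin 1 => if i.val + j.val + 1 = 1 then (1 : L) else 0)).Local v => finGammaTwo L v γH w :=
    (continuous_apply w).comp (continuous_finGammaTwo L v)
  have hcd : Continuous fun γH : (cmDatum L 2 (Matrix.of fun i j : Fin 2 => if i.val + j.val + 1 = 2 then (1 : L) else 0)).Local v ×
        (cmDatum L 1 (Matrix.of fun i j : Fin 1 => if i.val + j.val + 1 = 1 then (1 : L) else 0)).Local v =>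
      (((γH.1.val.val : Matrix (Fin 2) (Fin 2) (LocalRing L v)).map
        (Pi.evalRingHom (fun w' : PlacesOver L v => w'.1.adicCompletion L) w)).det) :=
    ((continuous_fst_localMatrix L v).matrix_map (continuous_apply w)).matrix_det
  have hu1 : finGammaTwo L v (1 : (cmDatum L 2 (Matrix.of fun i j : Fin 2 => if i.val + j.val + 1 = 2 then (1 : L) else 0)).Local v ×
        (cmDatum L 1 (Matrix.of fun i j : Fin 1 => if i.val + j.val + 1 = 1 then (1 : L) else 0)).Local v) w = 1 := by
    change (1 : Matrix (Fin 1) (Fin 1) (LocalRing L v)) 0 0 w = 1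
    rw [Matrix.one_apply_eq, Pi.one_apply]
  have hd1 : (((1 : (cmDatum L 2 (Matrix.of fun i j : Fin 2 => if i.val + j.val + 1 = 2 then (1 : L) else 0)).Local v ×
        (cmDatum L 1 (Matrix.of fun i j : Fin 1 => if i.val + j.val + 1 = 1 then (1 : L) else 0)).Local v).1.val.val :
          Matrix (Fin 2) (Fin 2) (LocalRing L v)).map (Pi.evalRingHom (fun w' : PlacesOver L v => w'.1.adicCompletion L) w)).det = 1 := by
    change ((1 : Matrix (Fin 2) (Fin 2) (LocalRing L v)).map (Pi.evalRingHom (fun w' : PlacesOver L v => w'.1.adicCompletion L) w)).det = 1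
    rw [Matrix.map_one _ (map_zero _) (map_one _), Matrix.det_one]
  have hball := setOf_valued_sub_one_le_mem_nhds_one L v w hc
  have eu := hcu.continuousAt.preimage_mem_nhds (by rw [hu1]; exact hball)
  have ed := hcd.continuousAt.preimage_mem_nhds (by rw [hd1]; exact hball)
  filter_upwards [eu, ed] with γH hu hd
  exact ⟨hu, hd⟩

include hw hunr hμω in
/-- **GERM FORM OF THE HEAD: `τ_v(γ_H) = (−1)^{ord_w χ_g(u)}` EVENTUALLY NEAR `1 ∈ H_v`** (non-split `v` unramified in `L`, guard `μ|_{𝕀_{L⁺}} = ω`; all torus types, `μ_w`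
possibly ramified). [cite: Rogawski1990, §4.9 p. 55; Prop. 8.1.3 p. 116] [cite: LabesseLanglands1979, §2] -/
theorem eventually_nhds_one_finTau_eq_neg_one_pow :
    ∀ᶠ γH : (cmDatum L 2 (Matrix.of fun i j : Fin 2 => if i.val + j.val + 1 = 2 then (1 : L) else 0)).Local v ×
        (cmDatum L 1 (Matrix.of fun i j : Fin 1 => if i.val + j.val + 1 = 1 then (1 : L) else 0)).Local v in 𝓝 1,
      ∀ n : ℕ, Valued.v (((finCharpolyTwo L v γH).eval (finGammaTwo L v γH)) w) =
          Valued.v ((toPlace v w (HeckeCharacter.uniformizer ↥(maximalRealSubfield L) v : v.adicCompletion ↥(maximalRealSubfield L))) ^ n) →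
        finTau L v γH μ = (-1 : ℂ) ^ n := by
  obtain ⟨M₀, -, h⟩ := exists_forall_finTau_eq_neg_one_pow_of_deep L v w hw hunr μ hμω
  have hϖv : Valued.v (toPlace v w (HeckeCharacter.uniformizer ↥(maximalRealSubfield L) v : v.adicCompletion ↥(maximalRealSubfield L))) =
      WithZero.exp (-1 : ℤ) := Liu2021.LemD1IndexedNonVacuityInertCofinite.valued_toPlace_uniformizer_of_isUnramifiedIn L v hunr w
  have hϖ0 : (toPlace v w (HeckeCharacter.uniformizer ↥(maximalRealSubfield L) v : v.adicCompletion ↥(maximalRealSubfield L))) ^ M₀ ≠ 0 :=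
    pow_ne_zero _ fun h0 => by rw [h0, map_zero] at hϖv; exact WithZero.zero_ne_coe hϖv
  filter_upwards [eventually_nhds_one_valued_sub_one_le L v w hϖ0] with γH hγ n hχ
  exact h γH n hχ hγ.1 hγ.2

include hw hunr hμω in
/-- **GERM FORM ON MATCHED PAIRS: `Δ‴_v(γ_H, γ′) = (−1)^n q_v^{−n}·κ_v(γ_H, γ′)` EVENTUALLY NEAR `1 ∈ H_v`** (`n = ord_w χ_g(u)`; non-split `v` unramified in `L`, guard).
[cite: Rogawski1990, §4.9 p. 55; Prop. 8.1.3 p. 116] [cite: LabesseLanglands1979, §2] -/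
theorem eventually_nhds_one_finExplicitDelta_eq_neg_pow_mul_kappa (H' : Matrix (Fin 3) (Fin 3) L) :
    ∀ᶠ γH : (cmDatum L 2 (Matrix.of fun i j : Fin 2 => if i.val + j.val + 1 = 2 then (1 : L) else 0)).Local v ×
        (cmDatum L 1 (Matrix.of fun i j : Fin 1 => if i.val + j.val + 1 = 1 then (1 : L) else 0)).Local v in 𝓝 1,
      ∀ (n : ℕ) (γ' : (cmDatum L 3 H').Local v),
        Valued.v (((finCharpolyTwo L v γH).eval (finGammaTwo L v γH)) w) =
          Valued.v ((toPlace v w (HeckeCharacter.uniformizer ↥(maximalRealSubfield L) v : v.adicCompletion ↥(maximalRealSubfield L))) ^ n) →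
        IsLocalNormPair L H' v γH γ' →
        finExplicitDelta L v H' γH μ γ' =
          (-1 : ℂ) ^ n * (((Nat.card (𝓞 ↥(maximalRealSubfield L) ⧸ v.asIdeal) : ℂ) ^ n))⁻¹ * ((finKappaAt L v H' γH γ' : ℤ) : ℂ) := by
  obtain ⟨M₀, -, h⟩ := exists_forall_finExplicitDelta_eq_neg_pow_mul_kappa_of_deep L v w hw hunr μ hμω H'
  have hϖv : Valued.v (toPlace v w (HeckeCharacter.uniformizer ↥(maximalRealSubfield L) v : v.adicCompletion ↥(maximalRealSubfield L))) =
      WithZero.exp (-1 : ℤ) := Liu2021.LemD1IndexedNonVacuityInertCofinite.valued_toPlace_uniformizer_of_isUnramifiedIn L v hunr w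
  have hϖ0 : (toPlace v w (HeckeCharacter.uniformizer ↥(maximalRealSubfield L) v : v.adicCompletion ↥(maximalRealSubfield L))) ^ M₀ ≠ 0 :=
    pow_ne_zero _ fun h0 => by rw [h0, map_zero] at hϖv; exact WithZero.zero_ne_coe hϖv
  filter_upwards [eventually_nhds_one_valued_sub_one_le L v w hϖ0] with γH hγ n γ' hχ hpair
  exact h γH n γ' hχ hγ.1 hγ.2 hpair

include hw hunr hμω in
/-- **`∃ V ∈ 𝓝 1, ∀ γ_H ∈ V`: `Δ‴_v(γ_H, γ′) = (−1)^n q_v^{−n}·κ_v(γ_H, γ′)` on matched pairs** — the `∃ V`-currency of the END contract's «GEN» stub (road «S3-tree»).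
[cite: Rogawski1990, §4.9 p. 55; Prop. 8.1.3 p. 116] -/
theorem exists_nhds_one_forall_finExplicitDelta_eq_neg_pow_mul_kappa (H' : Matrix (Fin 3) (Fin 3) L) :
    ∃ V ∈ 𝓝 (1 : (cmDatum L 2 (Matrix.of fun i j : Fin 2 => if i.val + j.val + 1 = 2 then (1 : L) else 0)).Local v ×
        (cmDatum L 1 (Matrix.of fun i j : Fin 1 => if i.val + j.val + 1 = 1 then (1 : L) else 0)).Local v),
      ∀ γH ∈ V, ∀ (n : ℕ) (γ' : (cmDatum L 3 H').Local v),
        Valued.v (((finCharpolyTwo L v γH).eval (finGammaTwo L v γH)) w) =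
          Valued.v ((toPlace v w (HeckeCharacter.uniformizer ↥(maximalRealSubfield L) v : v.adicCompletion ↥(maximalRealSubfield L))) ^ n) →
        IsLocalNormPair L H' v γH γ' →
        finExplicitDelta L v H' γH μ γ' =
          (-1 : ℂ) ^ n * (((Nat.card (𝓞 ↥(maximalRealSubfield L) ⧸ v.asIdeal) : ℂ) ^ n))⁻¹ * ((finKappaAt L v H' γH γ' : ℤ) : ℂ) :=
  Filter.Eventually.exists_mem (eventually_nhds_one_finExplicitDelta_eq_neg_pow_mul_kappa L v w hw hunr μ hμω H')

end Germ

end Literature.NumberTheory.Rogawski1990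

end
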